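import Summits.ResolutionOfSingularities.ResolutionOfSingularities.Theorems.HilbertSamuelEliminationSigmaMaxModificationsCorridor3WLadderRecognitionNearLocusFibres
import Literature.AlgebraicGeometry.CossartJannsenSaito2020.DirectrixSemicontinuity
import HarnessLib

/-!
# [OURS · L1 W4.2] RECOGNITION-GEOMETRY (R2) WITH A PARAMETRIC POINT HYPOTHESIS `F`, PART 1: near fibres over a curve centre are
# subsingletons; `π_{j+1}` injective on `N_{j+1}(x)` (crux chain w42, line `w_ladder`; `--supports stmt-…-19249`, helper)

OURS (cell res-hironaka, slot W4.2, seat res-L1-w42-stub-2 gen 4); NOT statements of H. Hironaka's manuscript [Hironaka2017]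
nor of [CossartJannsenSaito2020]. AI-drafted, weaker than expert review. Sorry-free PROOF file (no new definition).

This is `…WLadderRecognitionNearLocusFibres` §2 (CJS proof of Thm. 6.28 Step 2, p. 94; p. 104) RE-ISSUED with the point hypothesis
of CJS Thm. 3.14 as a PARAMETER `F : ∀ X [IsLocallyNoetherian X], X → Prop` — so that ONE proof serves the (F1) row
(`F := CharHypothesis`, binders = the printed facts `Thm314_nearFibre_subsingleton` / `CossartJannsenSaito2020_thm_3_14` / the P-b
door, the files `…RecognitionNearLocus{Fibres,Curve,Shape,Keys,Unit}`) AND the characteristic-`2` row `stub_Wlow3M_two`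
(`F := GeomDirHypothesis`, binders = the row's OURS carriers `Theorem314_nearFibre_geomDir`, `Theorem314_geomDir`,
`Thm314_point_locus_geomDir`; instantiated in `…RecognitionNearLocusTwo`). The standing point hypothesis becomes
`hF : ∀ i, ∀ y ∈ N_i(x), F (X_i) y` (for (F1): `BlowupTowerNear.charHypothesis_of_over`; for (F1♯) at level `N = 3`: `ē ≤ 2` at closed
near points and `ē ≤ dim 𝒪 ≤ 2` at non-closed ones). The `F`-independent plumbing is cited from `…RecognitionNearLocusFibres`
(`BlowupTowerNear.*`); CJS Thm. 3.6 enters BY NAME (`CossartJannsenSaito2020_thm_3_6`, F-65), Thm. 3.10 (4) as `h3104`.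

* `nearFibre_subsingleton_of_mem_centre` — over every `y ∈ C_j` the points of `X_{j+1}` near to `y` form a subsingleton;
* `nearLocus_succ_injOn` — `π_{j+1}` is injective on `N_{j+1}(x)`.

## References

* V. Cossart, U. Jannsen, S. Saito, LNM 2270 (2020): Thm. 3.6, Thm. 3.10, Thm. 3.14, (6.24), Def. 6.38, proof of Thm. 6.28 Step 2
  (p. 94), p. 104. [CossartJannsenSaito2020]
-/

noncomputable section

-- namespace `…Corridor3.Helpers` re-enters `…Corridor3`
set_option linter.dupNamespace false

open CategoryTheory AlgebraicGeometry TopologicalSpace IsLocalRing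
open Literature.AlgebraicGeometry.Resolution
open Scheme.IdealSheafData

universe u

open Literature.AlgebraicGeometry.CossartJannsenSaito2020

namespace Summit.ResolutionOfSingularities.ResolutionOfSingularities.Theorems.SigmaMaxModificationsCorridor3.Helpers

namespace BlowupTowerNearF

/-! The point hypothesis `F` (the rôle of (F1) `CharHypothesis` / (F1♯) `GeomDirHypothesis`) and the binders keyed on it are SECTION
VARIABLES: every theorem below takes them as its FIRST explicit arguments, in the order `F`, `h314f`[, `hPb`, `h314`]. -/

variable {T : BlowupTower.{u}} {N : ℕ}
  (F : ∀ (X : Scheme.{u}) [IsLocallyNoetherian X], X → Prop)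
  (h314f : ∀ (X X' : Scheme.{u}) [IsLocallyNoetherian X] (π : X' ⟶ X) (D : X.IdealSheafData),
    Scheme.IsExcellent X → IdealSheafData.IsPermissible D → IsBlowup π D →
      ∀ N : ℕ, topologicalKrullDim X ≤ (N : WithBot ℕ∞) →
        ∀ x : X, x ∈ D.support → F X x →
          (Scheme.dirDim X x : WithBot ℕ∞) ≤ ringKrullDim (X.presheaf.stalk x ⧸ stalkIdeal D x) + 1 →
            {x' : X' | π.base x' = x ∧ Scheme.hsFun X' N x' = Scheme.hsFun X N x}.Subsingleton)

include h314f

/-- **THE NEAR FIBRES OVER A CURVE CENTRE ARE SUBSINGLETONS.** Over every point `y` of an irreducible positive-dimensional centre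
`C_j ⊆ N_j(x)` (non-generic points closed, near loci inside the centres below), with `ē_x(X_0) ≤ 2` and (F1) at `x`, the points of
`X_{j+1}` near to `y` form a subsingleton: `e_y(X_j) ≤ dim 𝒪_{C_j,y} + 1` (closed `y`: `e_y ≤ 2`, `dim ≥ 1`; `y = η_j`: `e_η ≤ 1`,
CJS (6.24)) and CJS Thm. 3.14 (near-fibre rendering `Thm314_nearFibre_subsingleton`). [cite: CossartJannsenSaito2020, Thm. 3.14, Thm. 3.6, (6.24), p. 104] -/
theorem nearFibre_subsingleton_of_mem_centre (hT36 : CossartJannsenSaito2020_thm_3_6.{u})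
    (h3104 : CossartJannsenSaito2020_thm_3_10_4.{u}) (hkey : KeySetting T N)
    (hperm : ∀ j, IdealSheafData.IsPermissible (T.centreIdeal j)) {x : T.X 0}
    (hF : ∀ i, ∀ y ∈ T.nearLocus N x i, @F (T.X i) (T.ln i) y) (hē : T.geomDirDimAt 0 x ≤ 2) {j : ℕ}
    (hNC : ∀ i, i < j → T.nearLocus N x i ⊆ T.C i) (hCN : T.C j ⊆ T.nearLocus N x j)
    (hirr : IsIrreducible (T.C j)) (hnt : (T.C j).Nontrivial)
    (hpts : ∀ y ∈ T.C j, ¬ IsGenericPoint y (T.C j) → IsClosed ({y} : Set (T.X j)))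
    {y : T.X j} (hy : y ∈ T.C j) :
    {ξ : T.X (j + 1) | (T.π j).base ξ = y ∧ Scheme.hsFun (T.X (j + 1)) N ξ = Scheme.hsFun (T.X j) N y}.Subsingleton := by
  haveI : ∀ j, IsLocallyNoetherian (T.X j) := T.ln
  have hsupp : ((T.centreIdeal j).support : Set (T.X j)) = T.C j := by
    rw [BlowupTower.centreIdeal, Scheme.IdealSheafData.coe_support_vanishingIdeal]; rfl
  have hysupp : y ∈ (T.centreIdeal j).support := by rw [← SetLike.mem_coe, hsupp]; exact hy
  have hchary : F (T.X j) y := hF j y (hCN hy)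
  refine h314f (T.X j) (T.X (j + 1)) (T.π j) (T.centreIdeal j) (BlowupTowerNear.isExcellent T hkey j) (hperm j) (T.isBlowup j) N
    (BlowupTowerNear.topologicalKrullDim_le T hkey j) y hysupp hchary ?_
  -- `e_y(X_j) ≤ dim 𝒪_{C_j,y} + 1`
  have hnt' : Nontrivial ((T.X j).presheaf.stalk y ⧸ stalkIdeal (T.centreIdeal j) y) :=
    Ideal.Quotient.nontrivial_iff.mpr fun htop =>
      (maximalIdeal.isMaximal _).ne_top (top_le_iff.mp (htop ▸ (mem_support_iff_stalkIdeal_le _ y).mp hysupp))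
  have h0 : (0 : WithBot ℕ∞) ≤ ringKrullDim ((T.X j).presheaf.stalk y ⧸ stalkIdeal (T.centreIdeal j) y) :=
    ringKrullDim_nonneg_of_nontrivial
  by_cases hgen : IsGenericPoint y (T.C j)
  · -- generic point: `e_η ≤ 1 ≤ dim + 1`
    have h1 : T.dirDimAt j y + 1 ≤ 2 :=
      (BlowupTowerNear.dirDim_generic_succ_le hT36 h3104 hkey hperm x hNC hCN hirr hnt hpts hgen).trans hē
    have h2 : (Scheme.dirDim (T.X j) y : WithBot ℕ∞) ≤ 1 := by
      rw [← BlowupTower.dirDimAt_eq]; exact_mod_cast (by omega : T.dirDimAt j y ≤ 1)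
    calc (Scheme.dirDim (T.X j) y : WithBot ℕ∞) ≤ 0 + 1 := by rw [zero_add]; exact h2
      _ ≤ _ := add_le_add_left h0 _
  · -- closed point: `e_y ≤ 2 ≤ dim + 1`
    have hycl : IsClosed ({y} : Set (T.X j)) := hpts y hy hgen
    have h1 : T.dirDimAt j y ≤ 2 := (BlowupTowerNear.dirDim_le_of_mem_nearLocus h3104 hkey hperm x hNC (hCN hy) hycl).trans hē
    have h2 : (Scheme.dirDim (T.X j) y : WithBot ℕ∞) ≤ 1 + 1 := by
      rw [← BlowupTower.dirDimAt_eq]; exact_mod_cast h1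
    exact h2.trans (add_le_add_left (BlowupTowerNear.one_le_ringKrullDim_quotient_of_not_isGenericPoint hirr hy hgen) _)

/-- **`π_{j+1}` IS INJECTIVE ON THE NEAR LOCUS `N_{j+1}(x)`** over a curve centre `C_j = N_j(x)` (hypotheses of
`nearFibre_subsingleton_of_mem_centre`, and `N_j ⊆ C_j`): two near points over the same point of `C_j` coincide.
[cite: CossartJannsenSaito2020, Thm. 3.14, p. 104] -/
theorem nearLocus_succ_injOn (hT36 : CossartJannsenSaito2020_thm_3_6.{u})
    (h3104 : CossartJannsenSaito2020_thm_3_10_4.{u}) (hkey : KeySetting T N)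
    (hperm : ∀ j, IdealSheafData.IsPermissible (T.centreIdeal j)) {x : T.X 0}
    (hF : ∀ i, ∀ y ∈ T.nearLocus N x i, @F (T.X i) (T.ln i) y) (hē : T.geomDirDimAt 0 x ≤ 2) {j : ℕ}
    (hNC : ∀ i, i ≤ j → T.nearLocus N x i ⊆ T.C i) (hCN : T.C j ⊆ T.nearLocus N x j)
    (hirr : IsIrreducible (T.C j)) (hnt : (T.C j).Nontrivial)
    (hpts : ∀ y ∈ T.C j, ¬ IsGenericPoint y (T.C j) → IsClosed ({y} : Set (T.X j))) :
    Set.InjOn (T.π j).base (T.nearLocus N x (j + 1)) := by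
  intro a ha b hb hab
  have ha' := (BlowupTowerNear.mem_nearLocus_succ_iff T hkey hperm x j a).mp ha
  have hb' := (BlowupTowerNear.mem_nearLocus_succ_iff T hkey hperm x j b).mp hb
  have hyC : (T.π j).base a ∈ T.C j := hNC j le_rfl ha'.1
  refine nearFibre_subsingleton_of_mem_centre F h314f hT36 h3104 hkey hperm hF hē (fun i hi => hNC i hi.le) hCN hirr hnt
    hpts hyC ⟨rfl, ha'.2⟩ ⟨hab.symm, ?_⟩
  rw [hb'.2, hab]

end BlowupTowerNearF

end Summit.ResolutionOfSingularities.ResolutionOfSingularities.Theorems.SigmaMaxModificationsCorridor3.Helpers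

end
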